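import Mathlib
import Summits.NavierStokesRegularity.OSWSelfSimilar.SheetHalfLineLogKernelSeries
import HarnessLib

/-!
# The gCLM/OSW MODEL velocity–vorticity pairing on the half line is NEGATIVE DEFINITE (sign-free):
# `∫₀^∞ 𝒰Ω = −(4/π) Σ_{k≥0} ∫₀^∞ τ^{4k+1} L_{2k+1}(τ)² dτ ≤ 0`, with `= 0` iff `Ω ≡ 0`

HONEST FRAMING (cell ns-blowup GROUP B «PROFILE SEARCH», zone Z3 = the 1-D viscous gCLM/OSW sheet; human rulings
D-0035/D-0074): **a classical potential-theoretic fact (logarithmic energy of an odd = neutral charge; the `Ḣ^{−1/2}` pairing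
`∫_ℝ 𝒰Ω = −c‖Ω‖²_{Ḣ^{−1/2}}`), kernel-checked by a real-variable route as the second input of the SIGN-FREE tail-sign law on the
NS-type line (`SheetNSLineTailSign`); 1-D MODEL; not Euler, not Navier–Stokes; «violates: none — MODEL».**

OBJECT. `Ω` odd, `C¹` with `|Ω′| ≤ M` and `|Ω(y)| ≤ C/(1+y²)`; the MODEL velocity `𝒰` (`𝒰′ = HΩ`, `𝒰(0) = 0`,
`H = hilbertTransform`) is `𝒰(x) = π⁻¹∫₀^∞ Ω(y) log(|x−y|/(x+y)) dy` (`SheetHalfLineVelocityKernel`), so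
`∫₀^∞ 𝒰Ω = −π⁻¹ ∬_{(0,∞)²} Ω(x)Ω(y) log((x+y)/|x−y|)` (`= (2π)⁻¹∬_{ℝ²} Ω(x)Ω(y) log|x−y|` by oddness);
`L_n(τ) = ∫_τ^∞ Ω(y) y^{−n} dy`.

WHAT IS PROVED (no definitions; all [folklore]):
* `integral_Ioi_mul_logVelocity_eq` — `∫₀^∞ Ω·(π⁻¹∫Ω(y) log(|x−y|/(x+y))dy) = −π⁻¹∬ Ω(x)Ω(y) log((x+y)/|x−y|)`;
* **`hasSum_velocity_pairing`** — `HasSum (k ↦ −(4/π)∫₀^∞ τ^{4k+1} L_{2k+1}(τ)·L_{2k+1}(τ) dτ) (∫₀^∞ 𝒰Ω)` (the kernel series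
  and the square identity of `SheetHalfLineLogKernelSeries`, term by term: `(2/(2k+1))·(4k+2) = 4`);
* **`integral_Ioi_velocity_mul_nonpos`** — **`∫₀^∞ 𝒰Ω ≤ 0` for EVERY odd `C¹` profile in the decay class, no sign hypothesis**
  (Chen's class 3 gave this through the outward velocity `velocity_nonneg`; sign-changing `Ω` are now covered);
* **`eq_zero_of_integral_Ioi_velocity_mul_eq_zero`** — **strictness: `∫₀^∞ 𝒰Ω = 0 ⇒ Ω ≡ 0`** (all squares vanish; the `k = 0`
  term gives `τL₁(τ)² ≡ 0` on `(0,∞)`, so `L₁ ≡ 0` there and `Ω(τ)/τ = −L₁′(τ) = 0`, `hasDerivAt_tail`).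
USE: with the tail law `c_l·A = a∫₀^∞𝒰Ω` on the NS-type line (`nsTypeLine_tail_law`, p540197) this gives the SIGN-FREE tail-sign
law `sgn A = −sgn a` for every nontrivial profile (`SheetNSLineTailSign`).
bears_on: LADDER-NS N5 / zone Z3 clause (i′) (CENSUS-Z3 v2.11 §0, §3 [g11] pen remark) → N1 linear core. WHAT THIS IS NOT: not NS.
-/

noncomputable section
open Set Filter Topology MeasureTheory
open scoped Real

namespace Summit.NavierStokesRegularity.OSWSelfSimilar
namespace SheetHalfLine
open Literature.Analysis.Fourier

/-! ### Assembly: the pairing as a negative sum of squares -/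

/-- `∫₀^∞ Ω(x)·(π⁻¹∫₀^∞ Ω(y) log(|x−y|/(x+y)) dy) dx = −π⁻¹ ∬_{(0,∞)²} Ω(x)Ω(y) log((x+y)/|x−y|)`. [folklore] -/
theorem integral_Ioi_mul_logVelocity_eq {Om : ℝ → ℝ} {C : ℝ} (hc : Continuous Om)
    (hC : ∀ y, |Om y| ≤ C / (1 + y ^ 2)) :
    ∫ x in Ioi (0:ℝ), Om x * (π⁻¹ * ∫ y in Ioi (0:ℝ), Om y * Real.log (|x - y| / (x + y)))
      = -(π⁻¹ * ∫ p, Om p.1 * Om p.2 * Real.log ((p.1 + p.2) / |p.1 - p.2|)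
          ∂((volume.restrict (Ioi (0:ℝ))).prod (volume.restrict (Ioi (0:ℝ))))) := by
  rw [integral_prod _ (integrable_prod_mul_logKernel hc hC), ← integral_const_mul, ← integral_neg]
  refine integral_congr_ae (Eventually.of_forall fun x => ?_)
  have l : Om x * (π⁻¹ * ∫ y in Ioi (0:ℝ), Om y * Real.log (|x - y| / (x + y)))
      = ∫ y in Ioi (0:ℝ), Om x * (π⁻¹ * (Om y * Real.log (|x - y| / (x + y)))) := by
    rw [← integral_const_mul, ← integral_const_mul]
  have r : -(π⁻¹ * ∫ y in Ioi (0:ℝ), Om x * Om y * Real.log ((x + y) / |x - y|))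
      = ∫ y in Ioi (0:ℝ), -(π⁻¹ * (Om x * Om y * Real.log ((x + y) / |x - y|))) := by
    rw [← integral_const_mul, ← integral_neg]
  simp only
  rw [l, r]
  refine integral_congr_ae (Eventually.of_forall fun y => ?_)
  simp only
  rw [← inv_div, Real.log_inv]
  ring

/-- **THE VELOCITY–VORTICITY PAIRING IS A NEGATIVE SUM OF SQUARES (sign-free).** For an odd `C¹` profile `Ω` with
`|Ω′| ≤ M`, `|Ω(y)| ≤ C/(1+y²)` and its MODEL velocity `𝒰` (`𝒰′ = HΩ`, `𝒰(0) = 0`):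
`HasSum (k ↦ −(4/π)·∫₀^∞ τ^{4k+1}·L_{2k+1}(τ)·L_{2k+1}(τ) dτ) (∫₀^∞ 𝒰Ω)`, `L_n(τ) = ∫_τ^∞ Ω(y)(yⁿ)⁻¹ dy`
(`∫₀^∞𝒰Ω = −π⁻¹∬ΩΩ log((x+y)/|x−y|)`, the kernel series, and the square identity term by term). [folklore] -/
theorem hasSum_velocity_pairing {Om dOm U : ℝ → ℝ} {M C : ℝ} (hodd : ∀ y, Om (-y) = -Om y)
    (hOm : ∀ ξ, HasDerivAt Om (dOm ξ) ξ) (hdOmc : Continuous dOm) (hM : ∀ y, |dOm y| ≤ M)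
    (hC : ∀ y, |Om y| ≤ C / (1 + y ^ 2))
    (hU : ∀ ξ, HasDerivAt U (hilbertTransform Om ξ) ξ) (hU0 : U 0 = 0) :
    HasSum (fun k : ℕ => -(4 / π) * ∫ τ in Ioi (0:ℝ), τ ^ (4 * k + 1)
        * ((∫ y in Ioi τ, Om y * (y ^ (2 * k + 1))⁻¹) * (∫ y in Ioi τ, Om y * (y ^ (2 * k + 1))⁻¹)))
      (∫ x in Ioi (0:ℝ), U x * Om x) := by
  have hc : Continuous Om := continuous_iff_continuousAt.mpr fun y => (hOm y).continuousAt
  set μ : Measure ℝ := volume.restrict (Ioi (0:ℝ)) with hμ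
  -- ∫₀^∞ 𝒰Ω = −π⁻¹ ∬ ΩΩ log((x+y)/|x−y|)
  have hQ : ∫ x in Ioi (0:ℝ), U x * Om x
      = -(π⁻¹ * ∫ p, Om p.1 * Om p.2 * Real.log ((p.1 + p.2) / |p.1 - p.2|) ∂(μ.prod μ)) := by
    rw [← integral_Ioi_mul_logVelocity_eq hc hC]
    refine setIntegral_congr_fun measurableSet_Ioi fun x hx => ?_
    rw [velocity_eq_integral_logKernel hodd hOm hdOmc hM hC hU hU0 hx, mul_comm]
  rw [hQ, ← neg_mul]
  have h := (hasSum_integral_prod_logKernel hc hC).mul_left (-π⁻¹)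
  have e : ∀ k : ℕ, -π⁻¹ * ∫ p, (2:ℝ) * (1 / (2 * k + 1)) * (Om p.1 * Om p.2 * (min p.1 p.2 / max p.1 p.2) ^ (2 * k + 1))
        ∂(μ.prod μ)
      = -(4 / π) * ∫ τ in Ioi (0:ℝ), τ ^ (4 * k + 1)
        * ((∫ y in Ioi τ, Om y * (y ^ (2 * k + 1))⁻¹) * (∫ y in Ioi τ, Om y * (y ^ (2 * k + 1))⁻¹)) := by
    intro k
    rw [integral_const_mul, (integral_prod_mul_pow_ratio_eq hc hC (2 * k)).2]
    have e2 : ∫ τ in Ioi (0:ℝ), ((2 * ((2 * k : ℕ) : ℝ) + 2) * τ ^ (2 * (2 * k) + 1))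
          * ((∫ y in Ioi τ, Om y * (y ^ (2 * k + 1))⁻¹) * (∫ y in Ioi τ, Om y * (y ^ (2 * k + 1))⁻¹))
        = (4 * k + 2 : ℝ) * ∫ τ in Ioi (0:ℝ), τ ^ (4 * k + 1)
          * ((∫ y in Ioi τ, Om y * (y ^ (2 * k + 1))⁻¹) * (∫ y in Ioi τ, Om y * (y ^ (2 * k + 1))⁻¹)) := by
      rw [← integral_const_mul]
      refine integral_congr_ae (Eventually.of_forall fun τ => ?_)
      simp only
      rw [show 2 * (2 * k) + 1 = 4 * k + 1 by ring]
      push_cast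
      ring
    rw [e2]
    have hk : (2 * (k : ℝ) + 1) ≠ 0 := by positivity
    field_simp
    ring
  have hfun : (fun k : ℕ => -π⁻¹ * ∫ p, (2:ℝ) * (1 / (2 * k + 1))
        * (Om p.1 * Om p.2 * (min p.1 p.2 / max p.1 p.2) ^ (2 * k + 1)) ∂(μ.prod μ))
      = fun k : ℕ => -(4 / π) * ∫ τ in Ioi (0:ℝ), τ ^ (4 * k + 1)
        * ((∫ y in Ioi τ, Om y * (y ^ (2 * k + 1))⁻¹) * (∫ y in Ioi τ, Om y * (y ^ (2 * k + 1))⁻¹)) :=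
    funext e
  rw [hfun] at h
  exact h

/-- The square terms of `hasSum_velocity_pairing` are nonnegative. [folklore] -/
theorem sqTerm_nonneg (Om : ℝ → ℝ) (k : ℕ) :
    0 ≤ ∫ τ in Ioi (0:ℝ), τ ^ (4 * k + 1)
        * ((∫ y in Ioi τ, Om y * (y ^ (2 * k + 1))⁻¹) * (∫ y in Ioi τ, Om y * (y ^ (2 * k + 1))⁻¹)) :=
  setIntegral_nonneg measurableSet_Ioi fun _ hτ =>
    mul_nonneg (pow_nonneg (le_of_lt hτ) _) (mul_self_nonneg _)

/-- **`∫₀^∞ 𝒰Ω ≤ 0` — SIGN-FREE** (no sign hypothesis on `Ω`): the velocity–vorticity pairing of the gCLM/OSW MODEL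
on the half line is nonpositive for every odd `C¹` profile in the NS-type-line decay class. (In Chen's class 3 this was
`velocity_nonneg`; here `Ω` may change sign.) [folklore] -/
theorem integral_Ioi_velocity_mul_nonpos {Om dOm U : ℝ → ℝ} {M C : ℝ} (hodd : ∀ y, Om (-y) = -Om y)
    (hOm : ∀ ξ, HasDerivAt Om (dOm ξ) ξ) (hdOmc : Continuous dOm) (hM : ∀ y, |dOm y| ≤ M)
    (hC : ∀ y, |Om y| ≤ C / (1 + y ^ 2))
    (hU : ∀ ξ, HasDerivAt U (hilbertTransform Om ξ) ξ) (hU0 : U 0 = 0) :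
    ∫ x in Ioi (0:ℝ), U x * Om x ≤ 0 := by
  refine (hasSum_velocity_pairing hodd hOm hdOmc hM hC hU hU0).nonpos fun k => ?_
  have h4 : 0 ≤ 4 / π := by positivity
  have := sqTerm_nonneg Om k
  nlinarith

/-! ### Strictness: `∫₀^∞ 𝒰Ω = 0` forces `Ω ≡ 0` -/

/-- `y ↦ Ω(y)·(y¹)⁻¹` is integrable on `(a, ∞)` for `a > 0` (`|Ω(y)/y| ≤ (C/a)(1+y²)⁻¹` there). [folklore] -/
theorem integrableOn_div_Ioi {Om : ℝ → ℝ} {C : ℝ} (hc : Continuous Om) (hC : ∀ y, |Om y| ≤ C / (1 + y ^ 2))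
    {a : ℝ} (ha : 0 < a) : IntegrableOn (fun y => Om y * (y ^ 1)⁻¹) (Ioi a) := by
  have hC0 : 0 ≤ C := env_const_nonneg hC
  have hm : ContinuousOn (fun y => Om y * (y ^ 1)⁻¹) (Ioi a) :=
    hc.continuousOn.mul (((continuous_pow 1).continuousOn).inv₀ fun y hy =>
      pow_ne_zero _ (ha.trans (mem_Ioi.mp hy)).ne')
  refine Integrable.mono' ((integrable_inv_one_add_sq.const_mul (C / a)).integrableOn)
    (hm.aestronglyMeasurable measurableSet_Ioi) ?_
  refine (ae_restrict_iff' measurableSet_Ioi).mpr (Eventually.of_forall fun y hy => ?_)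
  have hay : a < y := hy
  have hy0 : 0 < y := ha.trans hay
  rw [Real.norm_eq_abs, abs_mul, pow_one, abs_inv, abs_of_pos hy0]
  calc |Om y| * y⁻¹ ≤ C / (1 + y ^ 2) * a⁻¹ := by
        refine mul_le_mul (hC y) ?_ (inv_nonneg.mpr hy0.le) (div_nonneg hC0 (by positivity))
        exact (inv_le_inv₀ hy0 ha).mpr hay.le
    _ = C / a * (1 + y ^ 2)⁻¹ := by ring

/-- The tail functional `L(τ) = ∫_τ^∞ Ω(y)/y dy` has derivative `−Ω(τ)/τ` at every `τ > 0`. [folklore] -/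
theorem hasDerivAt_tail {Om : ℝ → ℝ} {C : ℝ} (hc : Continuous Om) (hC : ∀ y, |Om y| ≤ C / (1 + y ^ 2))
    {τ : ℝ} (hτ : 0 < τ) :
    HasDerivAt (fun t => ∫ y in Ioi t, Om y * (y ^ 1)⁻¹) (-(Om τ * (τ ^ 1)⁻¹)) τ := by
  set g : ℝ → ℝ := fun y => Om y * (y ^ 1)⁻¹ with hg
  set a : ℝ := τ / 2 with ha
  have ha0 : 0 < a := by positivity
  have haτ : a < τ := by rw [ha]; linarith
  have hint := integrableOn_div_Ioi hc hC ha0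
  -- for t > a: ∫_{Ioi t} g = ∫_{Ioi a} g − ∫_a^t g
  have hsplit : ∀ t, a < t → ∫ y in Ioi t, g y = (∫ y in Ioi a, g y) - ∫ y in a..t, g y := by
    intro t hat
    rw [intervalIntegral.integral_of_le hat.le, ← Ioc_union_Ioi_eq_Ioi hat.le,
      setIntegral_union (Set.Ioc_disjoint_Ioi le_rfl) measurableSet_Ioi
      (hint.mono_set Ioc_subset_Ioi_self) (hint.mono_set (Ioi_subset_Ioi hat.le))]
    ring
  have hgc : ContinuousAt g τ :=
    (hc.continuousAt).mul (((continuous_pow 1).continuousAt).inv₀ (pow_ne_zero _ hτ.ne'))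
  have hcont : ContinuousOn g (Icc a τ) :=
    hc.continuousOn.mul (((continuous_pow 1).continuousOn).inv₀ fun y hy =>
      pow_ne_zero _ (ha0.trans_le hy.1).ne')
  have hFTC : HasDerivAt (fun t => ∫ y in a..t, g y) (g τ) τ :=
    intervalIntegral.integral_hasDerivAt_right (hcont.intervalIntegrable_of_Icc haτ.le)
      (hc.measurable.mul ((measurable_id.pow_const 1).inv)).aestronglyMeasurable.stronglyMeasurableAtFilter hgc
  have h2 : HasDerivAt (fun t => (∫ y in Ioi a, g y) - ∫ y in a..t, g y) (0 - g τ) τ :=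
    (hasDerivAt_const τ _).sub hFTC
  rw [zero_sub] at h2
  refine h2.congr_of_eventuallyEq ?_
  filter_upwards [Ioi_mem_nhds haτ] with t hat
  exact hsplit t hat

/-- **STRICTNESS: `∫₀^∞ 𝒰Ω = 0 ⇒ Ω ≡ 0`.** All square terms vanish; the `k = 0` term gives `τ·L₁(τ)² ≡ 0` on `(0,∞)`
(continuous nonnegative integrand, integrable by the Fubini identity), so `L₁ ≡ 0` there and `Ω(τ)/τ = −L₁′(τ) = 0`.
[folklore] -/
theorem eq_zero_of_integral_Ioi_velocity_mul_eq_zero {Om dOm U : ℝ → ℝ} {M C : ℝ} (hodd : ∀ y, Om (-y) = -Om y)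
    (hOm : ∀ ξ, HasDerivAt Om (dOm ξ) ξ) (hdOmc : Continuous dOm) (hM : ∀ y, |dOm y| ≤ M)
    (hC : ∀ y, |Om y| ≤ C / (1 + y ^ 2))
    (hU : ∀ ξ, HasDerivAt U (hilbertTransform Om ξ) ξ) (hU0 : U 0 = 0)
    (h0 : ∫ x in Ioi (0:ℝ), U x * Om x = 0) : Om = 0 := by
  have hc : Continuous Om := continuous_iff_continuousAt.mpr fun y => (hOm y).continuousAt
  set L : ℝ → ℝ := fun τ => ∫ y in Ioi τ, Om y * (y ^ 1)⁻¹ with hL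
  set T : ℕ → ℝ := fun k => ∫ τ in Ioi (0:ℝ), τ ^ (4 * k + 1)
      * ((∫ y in Ioi τ, Om y * (y ^ (2 * k + 1))⁻¹) * (∫ y in Ioi τ, Om y * (y ^ (2 * k + 1))⁻¹)) with hT
  have hS := hasSum_velocity_pairing hodd hOm hdOmc hM hC hU hU0
  rw [h0] at hS
  -- all square terms vanish, in particular the k = 0 term
  have hTnn : ∀ k, 0 ≤ T k := fun k => sqTerm_nonneg Om k
  have h4 : (0:ℝ) < 4 / π := by positivity
  have hS' : HasSum (fun k : ℕ => (4 / π) * T k) 0 := by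
    have := hS.neg
    simpa [neg_mul] using this
  have hzero : (fun k : ℕ => (4 / π) * T k) = 0 :=
    (hasSum_zero_iff_of_nonneg fun k => mul_nonneg h4.le (hTnn k)).mp hS'
  have hT0 : T 0 = 0 := by
    have := congr_fun hzero 0
    simp only [Pi.zero_apply, mul_eq_zero] at this
    rcases this with h | h
    · exact absurd h h4.ne'
    · exact h
  have hT0' : ∫ τ in Ioi (0:ℝ), τ ^ 1 * (L τ * L τ) = 0 := by
    simpa [hT, hL] using hT0
  -- the k = 0 integrand is integrable (Fubini identity), continuous and nonnegative on (0,∞), hence ≡ 0 there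
  have hint0 : IntegrableOn (fun τ => τ ^ 1 * (L τ * L τ)) (Ioi 0) := by
    have h := ((integral_prod_mul_pow_ratio_eq hc hC 0).1).const_mul (2⁻¹ : ℝ)
    refine h.congr (Eventually.of_forall fun τ => ?_)
    simp only [hL, Nat.cast_zero, mul_zero, zero_add]
    ring
  have hLd : ∀ τ, 0 < τ → HasDerivAt L (-(Om τ * (τ ^ 1)⁻¹)) τ := fun τ hτ => hasDerivAt_tail hc hC hτ
  have hLc : ContinuousOn L (Ioi 0) := fun τ hτ => (hLd τ hτ).continuousAt.continuousWithinAt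
  have hcont : ContinuousOn (fun τ => τ ^ 1 * (L τ * L τ)) (Ioi 0) :=
    ((continuous_pow 1).continuousOn).mul (hLc.mul hLc)
  have hz := eqOn_zero_of_nonneg_of_integral_eq_zero hcont
    (fun τ hτ => mul_nonneg (pow_nonneg (le_of_lt hτ) _) (mul_self_nonneg _)) hint0 hT0'
  have hL0 : ∀ τ, 0 < τ → L τ = 0 := by
    intro τ hτ
    have h := hz hτ
    simp only [Pi.zero_apply, mul_eq_zero, pow_one] at h
    rcases h with h | h
    · exact absurd h hτ.ne'
    · rcases h with h | h <;> exact h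
  -- L ≡ 0 on (0,∞) ⇒ L′ = −Ω(τ)/τ = 0 there
  have hOm0 : ∀ τ, 0 < τ → Om τ = 0 := by
    intro τ hτ
    have hd0 : HasDerivAt L 0 τ := by
      refine (hasDerivAt_const τ (0:ℝ)).congr_of_eventuallyEq ?_
      filter_upwards [Ioi_mem_nhds hτ] with t ht
      exact hL0 t ht
    have huniq := (hLd τ hτ).unique hd0
    have hτ1 : (τ ^ 1)⁻¹ ≠ 0 := inv_ne_zero (pow_ne_zero _ hτ.ne')
    have hprod : Om τ * (τ ^ 1)⁻¹ = 0 := by linarith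
    rcases mul_eq_zero.mp hprod with h | h
    · exact h
    · exact absurd h hτ1
  exact eq_zero_of_odd_of_eqOn_Ioi hodd fun τ hτ => hOm0 τ hτ

end SheetHalfLine
end Summit.NavierStokesRegularity.OSWSelfSimilar
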